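import Literature.Barriers.FinalStateConjecture.TrappingDerivativeLossEnergy
import HarnessLib

/-!
# Sbierski's Kerr trapping theorem in the admissible class: the barrier over genuine global
# solutions with compactly supported data, from the two canonical named facts
(companion file of `Literature/Barriers/FinalStateConjecture/TrappingDerivativeLoss.lean`; family
`gr`, summit `FinalStateConjecture`; namespace `Literature.Barriers.FinalStateConjecture`;
barrier audit of `TrappingDerivativeLossProofs.lean`, 2026-08-15)

## The gap this file closes

The barrier declaration `SbierskiTrappingObstruction` (parent file) negates the uniform estimate
`E_loc(τ, R) ≤ P(τ) E₀`, `P → 0`, over the class `𝒞_bar` of `C^∞` functions `ψ` on the exterior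
chart `{r > r₊}` that solve `□_g ψ = 0` **on `{t* > 0}` only** and whose Cauchy data vanish at the
points of the initial leaf with `‖y‖ > R` (so the data may extend up to the horizon end of the open
leaf `{t* = 0} ∩ {r > r₊}`). The positive linear-wave facts of the prelude (gr.S24:
`drsr_wave_boundedness_kerr`, `drsr_wave_integrated_decay_kerr`, `drsr_wave_polynomial_decay_kerr`,
…) are stated over `IsAdmissibleKerrWave M a ψ` (`BlackHoles.lean`): `ψ` smooth, `□_g ψ = 0` on the
**whole** chart, data **compactly supported in the open leaf**. Writing `𝒞_adm,R` for the admissible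
waves whose data moreover vanish for `‖y‖ > R`, one has `𝒞_adm,R ⊊ 𝒞_bar`, and a negated uniform
statement is the *weaker* the larger the class: `SbierskiTrappingObstruction` does **not** imply the
failure of loss-free uniform (integrated) local energy decay over admissible waves — the form in
which a route (or the first-order analogue of `drsr_wave_integrated_decay_kerr`, whose right-hand
side is the *second*-order energy) would state it, and the form a refuter needs to close such an
item by `¬`. The printed theorem is about genuine solutions of the wave equation on `D(Σ₀)` with the
compactly supported data of a Gaussian beam (Sbierski, Anal. PDE 8 (2015), proof of Thm. 2.1,
Thm. 5.1), and the tree's own derivation of `SbierskiKerrLocalisedSolutions`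
(`…of_waveCauchyProblem_of_trappedGeodesicBeams`, `TrappingDerivativeLossEnergy.lean`) constructs
exactly such witnesses — global solutions on the chart (`kerr_localEnergyEstimate_of_waveCauchyProblem`:
"a `C^∞` solution `ψ` of `□ ψ = 0` on the *whole* chart with the Cauchy data of `u`") with data
vanishing off the compact support `S` of the cut-off beam
(`SbierskiKerrTrappedGeodesicBeams.gaussianBeams_uniformSupport`) — and then forgets both
properties when packaging them into the vendored rendering. This file keeps them.

## Contents

All declarations of this file are **theorems** whose hypotheses are the two canonical named facts
`KerrSchild.waveCauchyProblem` and `SbierskiKerrTrappedGeodesicBeams` (no new named fact, D-0026;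
cf. the review-split of `AretakisInstabilityNarrow`): the sharper barrier is recorded as a theorem
named like a barrier declaration, so that it enters no debt census and its trust base is visibly
that of `SbierskiTrappingObstruction` (`TrappingDerivativeLossEnergy.lean`).

* `exists_admissibleLocalisedSolutions_of_waveCauchyProblem_of_trappedGeodesicBeams` — Thm. 5.1
  rendered with **admissible** witnesses, **proved** from the two facts (the proof of
  `SbierskiKerrLocalisedSolutions.of_waveCauchyProblem_of_trappedGeodesicBeams` verbatim, retaining
  the global wave equation and the compact support).
* `SbierskiTrappingObstructionAdmissible` — **the corrected (sharper) barrier**, a theorem from the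
  two facts (Thm. 5.5 argument): loss-free uniform LED fails already over admissible Kerr waves
  with data in the ball. The statement implies `SbierskiTrappingObstruction`
  (`SbierskiTrappingObstruction.of_admissible`), hence the print-literal `SbierskiKerrTrappingLED`.
* `SbierskiIntegratedDecayObstructionAdmissible` — the ILED criterion (Thm. 5.7 = arXiv Thm. 10)
  in the admissible class, from the two facts: no constant `C'` gives
  `∫₀^∞ E_loc(τ, R) dτ ≤ C' · E₀` uniformly over admissible waves with data in the ball — the
  first-order analogue of `drsr_wave_integrated_decay_kerr` is false (its derivative loss cannot
  be removed).

## References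

* J. Sbierski, *Characterisation of the energy of Gaussian beams on Lorentzian manifolds: with
  applications to black hole spacetimes*, Anal. PDE 8 (2015) 1379–1420 (arXiv:1311.2477): proof of
  Thm. 2.1 (arXiv Thm. 1, p. 9: the initial value problem for `v_λ` with the data of the beam,
  "supp(ũ) ⊆ 𝒩"), Thm. 5.1 (arXiv Thm. 8, p. 17), Thm. 5.5 and Thm. 5.7 with their proofs (arXiv
  Thms. 9, 10, p. 18), §7A and Thm. 7.4 (arXiv §3.2.1, Thm. 14, pp. 26–27) (key `Sbierski2015`).
* M. Dafermos, I. Rodnianski, Y. Shlapentokh-Rothman, arXiv:1402.7034 = Ann. of Math. 183 (2016),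
  §4.1 (reduction to smooth compactly supported data — the class `IsAdmissibleKerrWave`).
-/

noncomputable section

open Set Filter
open scoped Manifold ContDiff ENNReal Topology

namespace Literature.Barriers.FinalStateConjecture

open Literature.Geometry.Lorentzian
open _root_.MeasureTheory Metric

/-- **Sbierski's localised solutions with admissible witnesses, from the two canonical named
facts** (Thm. 5.1 with §7A rendered, the witnesses being admissible Kerr waves): for `0 < M`,
`0 ≤ a ≤ M` there is `R₀` such that for every `R ≥ R₀` there are `c > 0`, `C` with: for every
`T ≥ 0` some `ψ` with `IsAdmissibleKerrWave M a ψ`, Cauchy data vanishing for `‖y‖ > R`,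
`sliceEnergy ψ 0 ≤ C` and `c ≤ localSliceEnergy ψ τ R` for `τ ∈ [0, T]`. Proof: that of
`SbierskiKerrLocalisedSolutions.of_waveCauchyProblem_of_trappedGeodesicBeams`
(`TrappingDerivativeLossEnergy.lean`) verbatim — the compact set `S` of the cut-off beams
(`SbierskiKerrTrappedGeodesicBeams.gaussianBeams_uniformSupport`), the support-local energy
estimate with its global solution (`kerr_localEnergyEstimate_of_waveCauchyProblem`), `ε` with
`K ε ≤ c_B / 4`, the beam `u`, the solution `ψ` with the data of `u` — now recording that `ψ`
solves the wave equation on the whole chart and that its data vanish, with their differential,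
off the compact `S` (on the open complement of `S` the beam vanishes identically). Sbierski,
Anal. PDE 8 (2015), proof of Thm. 2.1 and Thm. 5.1 with §7A.
[cite: Sbierski2015, Thm. 2.1 (proof) and Thm. 5.1 with §7A; BarGinouxPfaffle2007 Thm. 3.2.11] -/
theorem exists_admissibleLocalisedSolutions_of_waveCauchyProblem_of_trappedGeodesicBeams
    (h : KerrSchild.waveCauchyProblem) (hB : SbierskiKerrTrappedGeodesicBeams)
    [Kerr.Facts] [Kerr.SliceFacts] {M a : ℝ} (hM : 0 < M) (ha₀ : 0 ≤ a) (haM : a ≤ M) :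
    ∃ R₀ : ℝ, ∀ R : ℝ, R₀ ≤ R →
      ∃ c C : ℝ, 0 < c ∧ ∀ T : ℝ, 0 ≤ T →
        ∃ ψ : Kerr.exterior M a → ℝ, IsAdmissibleKerrWave M a ψ ∧
          (∀ x : Kerr.exterior M a, (x : E4) 0 = 0 → R < E4.spatialNorm (x : E4) →
            ψ x = 0 ∧ mfderiv 𝓘(ℝ, E4) 𝓘(ℝ, ℝ) ψ x = 0) ∧
          sliceEnergy (Kerr.exterior M a) ψ 0 ≤ ENNReal.ofReal C ∧
          ∀ τ : ℝ, 0 ≤ τ → τ ≤ T →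
            ENNReal.ofReal c ≤ localSliceEnergy (Kerr.exterior M a) ψ τ R := by
  obtain ⟨R₀, hR⟩ := hB.gaussianBeams_uniformSupport hM ha₀ haM
  refine ⟨R₀, fun R hRR ↦ ?_⟩
  obtain ⟨cB, C, hcB, hbeamT⟩ := hR R hRR
  refine ⟨cB / 4, C, by positivity, fun T hT ↦ ?_⟩
  obtain ⟨S, hS, hbeam⟩ := hbeamT T hT
  obtain ⟨K, hKfin, hsolve⟩ := kerr_localEnergyEstimate_of_waveCauchyProblem h hM S hS T
  -- ### choice of `ε` with `K · ε ≤ c_B / 4`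
  set k : ℝ := K.toReal with hk
  have hk0 : 0 ≤ k := ENNReal.toReal_nonneg
  set ε : ℝ := cB / (4 * (k + 1)) with hε_def
  have hε : 0 < ε := by positivity
  have hKε : K * ENNReal.ofReal ε ≤ ENNReal.ofReal (cB / 4) := by
    have hKT : K = ENNReal.ofReal k := (ENNReal.ofReal_toReal hKfin.ne).symm
    rw [hKT, ← ENNReal.ofReal_mul hk0]
    refine ENNReal.ofReal_le_ofReal ?_
    rw [hε_def, mul_div_assoc']
    rw [div_le_div_iff₀ (by positivity) (by positivity)]
    nlinarith
  -- ### the beam and the global solution with its data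
  obtain ⟨u, hu, hsupp, hdata, hE₀, hbox, hloc⟩ := hbeam ε hε
  obtain ⟨ψ, hψ, hwave, hagree, hest⟩ := hsolve u hu hsupp
  have hinf : (∞ : ℕ∞ω) ≠ 0 := by simp
  refine ⟨ψ, ⟨hψ, hwave, S, hS, fun x hx0 hxS ↦ ?_⟩, ?_, ?_, ?_⟩
  · -- admissibility: the data of `ψ` are those of `u`, which vanishes on the open set `Sᶜ`
    obtain ⟨h1, h2⟩ := hagree x hx0
    refine ⟨h1.trans (hsupp x hxS), ?_⟩
    rw [h2]
    exact mfderiv_eq_zero_of_eqOn_zero hS.isClosed.isOpen_compl (fun z hz ↦ hsupp z hz) hxS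
  · intro x hx0 hxR
    obtain ⟨h1, h2⟩ := hagree x hx0
    obtain ⟨h3, h4⟩ := hdata x hx0 hxR
    exact ⟨h1.trans h3, h2.trans h4⟩
  · rw [sliceEnergy_congr_of_mfderiv_eq hinf hψ hu 0 fun x hx ↦ (hagree x hx).2]
    exact hE₀
  · intro τ hτ₀ hτT
    have hsplit := localSliceEnergy_le_two_mul_add (U := Kerr.exterior M a) hinf hψ hu τ R
    have hdiff : localSliceEnergy (Kerr.exterior M a) (ψ - u) τ R ≤ ENNReal.ofReal (cB / 4) :=
      calc localSliceEnergy (Kerr.exterior M a) (ψ - u) τ R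
          ≤ sliceEnergy (Kerr.exterior M a) (ψ - u) τ := localSliceEnergy_le_sliceEnergy _ _ _ _
        _ ≤ K * slabSqNorm (Kerr.exterior M a) (fun x ↦
              (Kerr.smoothMetric M a (Kerr.rPlus M a)).toPseudoRiemannianMetric.dalembertian u x)
              T := hest τ hτ₀ hτT
        _ ≤ K * ENNReal.ofReal ε := by gcongr
        _ ≤ ENNReal.ofReal (cB / 4) := hKε
    have hmain : ENNReal.ofReal cB ≤
        2 * localSliceEnergy (Kerr.exterior M a) ψ τ R + ENNReal.ofReal (cB / 2) :=
      calc ENNReal.ofReal cB ≤ localSliceEnergy (Kerr.exterior M a) u τ R := hloc τ hτ₀ hτT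
        _ ≤ 2 * localSliceEnergy (Kerr.exterior M a) ψ τ R +
              2 * localSliceEnergy (Kerr.exterior M a) (ψ - u) τ R := hsplit
        _ ≤ 2 * localSliceEnergy (Kerr.exterior M a) ψ τ R + 2 * ENNReal.ofReal (cB / 4) := by
            gcongr
        _ = 2 * localSliceEnergy (Kerr.exterior M a) ψ τ R + ENNReal.ofReal (cB / 2) := by
            rw [← ENNReal.ofReal_ofNat 2, ← ENNReal.ofReal_mul zero_le_two]
            congr 2
            ring
    by_contra hlt
    rw [not_le] at hlt
    have h2lt : 2 * localSliceEnergy (Kerr.exterior M a) ψ τ R < 2 * ENNReal.ofReal (cB / 4) :=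
      ENNReal.mul_lt_mul_right two_ne_zero ENNReal.ofNat_ne_top hlt
    have h3 : 2 * localSliceEnergy (Kerr.exterior M a) ψ τ R + ENNReal.ofReal (cB / 2) <
        2 * ENNReal.ofReal (cB / 4) + ENNReal.ofReal (cB / 2) :=
      ENNReal.add_lt_add_right ENNReal.ofReal_ne_top h2lt
    have h4 : 2 * ENNReal.ofReal (cB / 4) + ENNReal.ofReal (cB / 2) = ENNReal.ofReal cB := by
      rw [← ENNReal.ofReal_ofNat 2, ← ENNReal.ofReal_mul zero_le_two,
        ← ENNReal.ofReal_add (by positivity) (by positivity)]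
      congr 1
      ring
    rw [h4] at h3
    exact absurd (hmain.trans_lt h3) (lt_irrefl _)

/-- **Barrier (Sbierski), admissible-class form, proved from the two canonical named facts: on the
Kerr exterior `0 ≤ a ≤ M`, `M > 0`, loss-free uniform local energy decay fails already over
admissible waves — genuine `C^∞` solutions of `□_g ψ = 0` on the whole exterior chart whose Cauchy
data are compactly supported in the open initial leaf — with data in the ball carrying the trapped
set.** Sbierski, Anal. PDE 8 (2015), Thm. 7.4 through Thm. 5.5 and Thm. 5.1: the contradicting
solutions are the solutions `v` of the initial value problem with the data of a Gaussian beam `ũ`,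
"supp(ũ) ⊆ 𝒩", `𝒩` a prescribed neighbourhood of the trapped null geodesic `γ_{r₀}` (proof of
Thm. 2.1), i.e. genuine solutions with compactly supported data. **Statement** (hypotheses: the
Cauchy problem on generalised Kerr–Schild backgrounds `KerrSchild.waveCauchyProblem` —
Bär–Ginoux–Pfäffle Thm. 3.2.11 with Choquet-Bruhat–Cotsakis Thm. 2.1 — and the literal beam fact
`SbierskiKerrTrappedGeodesicBeams`, i.e. exactly the trust base of `SbierskiTrappingObstruction`,
`TrappingDerivativeLossEnergy.lean`): for `0 < M`, `0 ≤ a ≤ M` there is `R₀` such that for every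
`R ≥ R₀` and every `P : ℝ → ℝ` with `P > 0` and `P(τ) → 0`, it is **not** the case that every `ψ`
with `IsAdmissibleKerrWave M a ψ` whose Cauchy data vanish (`ψ = 0`, `dψ = 0`) at the points of
`{t* = 0} ∩ {r > r₊}` with `‖y‖ > R` satisfies `localSliceEnergy ψ τ R ≤ P(τ) · sliceEnergy ψ 0`
for all `τ ≥ 0`. This is formally STRONGER than `SbierskiTrappingObstruction`
(`SbierskiTrappingObstruction.of_admissible`: the admissible class is smaller, module docstring)
and is the form that meets the solution class `IsAdmissibleKerrWave` of the prelude's positive decay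
facts (gr.S24). Proof: the Thm. 5.5 argument ("Assume the contrary […] we obtain a contradiction")
on the admissible localised solutions — given `R ≥ R₀` and `P`, take `c > 0`, `C` and `T ≥ 0` with
`P(T) · C < c`; the admissible witness for this `T` has
`localSliceEnergy ψ T R ≥ c > P(T) · C ≥ P(T) · sliceEnergy ψ 0`.

BARRIER (D-0021; sharper form of the block of `SbierskiTrappingObstruction`, whose clauses apply
verbatim with "solutions" read as admissible waves):
* technique_class: kerr-stability, energy-estimates, morawetz, local-energy-decay, non-degenerate-estimates, vectorfield-method, first-order-energy
* blocks: loss-free uniform local-energy-decay estimates `E^N_τ[u](Σ_τ ∩ {‖y‖ ≤ R}) ≤ P(τ) E^N_0[u]`, `P → 0`, and (companion theorem `SbierskiIntegratedDecayObstructionAdmissible`) their integrated form `∫₀^∞ E^N_τ[u](Σ_τ ∩ {‖y‖ ≤ R}) dτ ≤ C E^N_0[u]`, on a Kerr exterior `0 ≤ a ≤ M`, uniform over ADMISSIBLE waves (`IsAdmissibleKerrWave`: global smooth solutions with data compactly supported in the open leaf) with data in the ball carrying the trapped set and controlled by the non-degenerate first-order initial energy alone [cite: Sbierski2015, Thm.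 7.4, Thm. 5.5, Thm. 5.7 and Thm. 5.1]; in particular the first-order analogues of the prelude's `drsr_wave_integrated_decay_kerr` / `drsr_wave_polynomial_decay_kerr` (stated over the same class with second-order right-hand sides) [cite: DafermosRodnianskiShlapentokhrothman2014, Thm. 3.2].
* because: as for `SbierskiTrappingObstruction`; the witnesses of Thm. 5.1 are the solutions of the initial value problem with the data of a Gaussian beam supported in the prescribed neighbourhood `𝒩` of the trapped geodesic ("supp(ũ) ⊆ 𝒩", proof of Thm. 2.1), hence genuine solutions with compactly supported data [cite: Sbierski2015, Thm. 5.1 and proof of Thm. 2.1]; in the tree they are the global solutions of `kerr_localEnergyEstimate_of_waveCauchyProblem` with the data of the compactly supported cut-off beams of `SbierskiKerrTrappedGeodesicBeams.gaussianBeams_uniformSupport`.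
* evasions_known: as for `SbierskiTrappingObstruction` (degenerate at trapping / loss of an `ε` or a logarithm of a derivative / time-integrated dispersive norms) [cite: Sbierski2015, §6A (pp. 1400–1401)] [cite: TataruTohaneanu2010, Thm. 3 ff.].
* scope_caveats: (i)–(vii) of `SbierskiTrappingObstruction` apply verbatim; this theorem removes its caveat (viii) (solution class) and nothing else: LED/ILED forms on coordinate balls `{‖y‖ ≤ R}`, `R ≥ R₀` inexplicit, coordinate energies of the Kerr–Schild foliation, `0 ≤ a ≤ M` only; hypotheses are the two undischarged canonical facts of the trust base of `SbierskiTrappingObstruction` [cite: Sbierski2015, Thm. 7.4].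
* status: established — theorem [cite: Sbierski2015, Thm. 7.4] (here: proved relative to `KerrSchild.waveCauchyProblem` and `SbierskiKerrTrappedGeodesicBeams`). -/
theorem SbierskiTrappingObstructionAdmissible
    (h : KerrSchild.waveCauchyProblem) (hB : SbierskiKerrTrappedGeodesicBeams) :
    ∀ [Kerr.Facts] [Kerr.SliceFacts] (M a : ℝ), 0 < M → 0 ≤ a → a ≤ M →
      ∃ R₀ : ℝ, ∀ R : ℝ, R₀ ≤ R →
        ∀ P : ℝ → ℝ, (∀ τ, 0 < P τ) → Tendsto P atTop (𝓝 0) →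
          ¬ ∀ ψ : Kerr.exterior M a → ℝ, IsAdmissibleKerrWave M a ψ →
              (∀ x : Kerr.exterior M a, (x : E4) 0 = 0 → R < E4.spatialNorm (x : E4) →
                ψ x = 0 ∧ mfderiv 𝓘(ℝ, E4) 𝓘(ℝ, ℝ) ψ x = 0) →
              ∀ τ : ℝ, 0 ≤ τ →
                localSliceEnergy (Kerr.exterior M a) ψ τ R ≤
                  ENNReal.ofReal (P τ) * sliceEnergy (Kerr.exterior M a) ψ 0 := by
  intro _ _ M a hM ha₀ haM
  obtain ⟨R₀, hR⟩ :=
    exists_admissibleLocalisedSolutions_of_waveCauchyProblem_of_trappedGeodesicBeams h hB hM ha₀ haM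
  refine ⟨R₀, fun R hRR P hP hP0 hall ↦ ?_⟩
  obtain ⟨c, C, hc, hsol⟩ := hR R hRR
  -- a time `T ≥ 0` at which the putative rate is already below `c / C`
  have hev : ∀ᶠ τ in atTop, P τ * C < c := by
    have hmul : Tendsto (fun τ ↦ P τ * C) atTop (𝓝 (0 * C)) := hP0.mul_const C
    rw [zero_mul] at hmul
    exact hmul.eventually (Iio_mem_nhds hc)
  obtain ⟨T, hT₀, hTc⟩ := ((eventually_ge_atTop (0 : ℝ)).and hev).exists
  obtain ⟨ψ, hψ, hsupp, hE₀, hloc⟩ := hsol T hT₀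
  -- the putative estimate at `τ = T` for this admissible localised solution
  have hle : localSliceEnergy (Kerr.exterior M a) ψ T R ≤ ENNReal.ofReal (P T * C) :=
    calc localSliceEnergy (Kerr.exterior M a) ψ T R
        ≤ ENNReal.ofReal (P T) * sliceEnergy (Kerr.exterior M a) ψ 0 := hall ψ hψ hsupp T hT₀
      _ ≤ ENNReal.ofReal (P T) * ENNReal.ofReal C := by gcongr
      _ = ENNReal.ofReal (P T * C) := (ENNReal.ofReal_mul (hP T).le).symm
  have hlt : ENNReal.ofReal (P T * C) < ENNReal.ofReal c :=
    (ENNReal.ofReal_lt_ofReal_iff hc).2 hTc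
  exact absurd ((hloc T hT₀ le_rfl).trans hle) (not_le.2 hlt)

/-- **The admissible-class obstruction implies the recorded one**: an admissible violating wave with
data in the ball is in particular a `C^∞` function solving the wave equation on `{t* > 0}` with data
in the ball, so the negated uniform statement over the larger class `SbierskiTrappingObstruction`
(and with it the print-literal `SbierskiKerrTrappingLED`, `SbierskiTrappingObstruction.literal`)
follows from the statement of `SbierskiTrappingObstructionAdmissible` (taken here as a hypothesis,
whatever its provenance). Sbierski, Anal. PDE 8 (2015), Thm. 7.4. [cite: Sbierski2015, Thm. 7.4] -/
theorem SbierskiTrappingObstruction.of_admissible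
    (hadm : ∀ [Kerr.Facts] [Kerr.SliceFacts] (M a : ℝ), 0 < M → 0 ≤ a → a ≤ M →
      ∃ R₀ : ℝ, ∀ R : ℝ, R₀ ≤ R →
        ∀ P : ℝ → ℝ, (∀ τ, 0 < P τ) → Tendsto P atTop (𝓝 0) →
          ¬ ∀ ψ : Kerr.exterior M a → ℝ, IsAdmissibleKerrWave M a ψ →
              (∀ x : Kerr.exterior M a, (x : E4) 0 = 0 → R < E4.spatialNorm (x : E4) →
                ψ x = 0 ∧ mfderiv 𝓘(ℝ, E4) 𝓘(ℝ, ℝ) ψ x = 0) →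
              ∀ τ : ℝ, 0 ≤ τ →
                localSliceEnergy (Kerr.exterior M a) ψ τ R ≤
                  ENNReal.ofReal (P τ) * sliceEnergy (Kerr.exterior M a) ψ 0) :
    SbierskiTrappingObstruction := by
  intro _ _ M a hM ha₀ haM
  obtain ⟨R₀, hR⟩ := hadm M a hM ha₀ haM
  refine ⟨R₀, fun R hRR P hP hP0 hall ↦ hR R hRR P hP hP0 fun ψ hψ hsupp ↦ ?_⟩
  exact hall ψ hψ.contMDiff (fun x _ ↦ hψ.dalembertian_eq_zero x) hsupp

/-- **The ILED criterion in the admissible class, from the two canonical named facts** (Sbierski,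
Anal. PDE 8 (2015), Thm. 5.7 = arXiv Thm. 10, applied along the trapped `γ_{r₀}` of §7A, whose
`N`-energy is bounded below so that `∫₀^∞ −g(N, γ̇)|_{Im γ ∩ Σ_τ} dτ = ∞`; "the proof of this
theorem goes along the same lines as the one of Theorem [5.5]"): for `0 < M`, `0 ≤ a ≤ M` there is
`R₀` such that for every `R ≥ R₀` and every real `C'` it is **not** the case that every admissible
Kerr wave `ψ` with Cauchy data vanishing for `‖y‖ > R` satisfies
`∫₀^∞ localSliceEnergy ψ τ R dτ ≤ C' · sliceEnergy ψ 0`. In particular the second-order energy on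
the right-hand side of `drsr_wave_integrated_decay_kerr` (DRSR Thm. 3.2 (25), vendored over the same
class `IsAdmissibleKerrWave`) cannot be replaced by the first-order energy. Proof: with `c`, `C`
from the admissible localised solutions take `T = (|C'| |C| + c) / c`; the witness for this `T`
has `∫₀^∞ E_loc ≥ c T = |C'| |C| + c > |C'| |C| ≥ C' · sliceEnergy ψ 0`.
[cite: Sbierski2015, Thm. 5.7 and §7A] -/
theorem SbierskiIntegratedDecayObstructionAdmissible
    (h : KerrSchild.waveCauchyProblem) (hB : SbierskiKerrTrappedGeodesicBeams)
    [Kerr.Facts] [Kerr.SliceFacts] {M a : ℝ} (hM : 0 < M) (ha₀ : 0 ≤ a) (haM : a ≤ M) :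
    ∃ R₀ : ℝ, ∀ R : ℝ, R₀ ≤ R → ∀ C' : ℝ,
      ¬ ∀ ψ : Kerr.exterior M a → ℝ, IsAdmissibleKerrWave M a ψ →
          (∀ x : Kerr.exterior M a, (x : E4) 0 = 0 → R < E4.spatialNorm (x : E4) →
            ψ x = 0 ∧ mfderiv 𝓘(ℝ, E4) 𝓘(ℝ, ℝ) ψ x = 0) →
          ∫⁻ τ in Ici (0 : ℝ), localSliceEnergy (Kerr.exterior M a) ψ τ R ≤
            ENNReal.ofReal C' * sliceEnergy (Kerr.exterior M a) ψ 0 := by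
  obtain ⟨R₀, hR⟩ :=
    exists_admissibleLocalisedSolutions_of_waveCauchyProblem_of_trappedGeodesicBeams h hB hM ha₀ haM
  refine ⟨R₀, fun R hRR C' hall ↦ ?_⟩
  obtain ⟨c, C, hc, hsol⟩ := hR R hRR
  -- a time `T ≥ 0` with `c · T > |C'| · |C|`
  set T : ℝ := (|C'| * |C| + c) / c with hT
  have hT₀ : 0 ≤ T := by positivity
  have hcT : c * T = |C'| * |C| + c := by rw [hT]; field_simp
  obtain ⟨ψ, hψ, hsupp, hE₀, hloc⟩ := hsol T hT₀
  -- lower bound: the local energy in the ball is `≥ c` throughout `[0, T]`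
  have hlow : ENNReal.ofReal (c * T) ≤
      ∫⁻ τ in Ici (0 : ℝ), localSliceEnergy (Kerr.exterior M a) ψ τ R :=
    calc ENNReal.ofReal (c * T) = ∫⁻ _ in Icc (0 : ℝ) T, ENNReal.ofReal c := by
          rw [setLIntegral_const, Real.volume_Icc, sub_zero, ENNReal.ofReal_mul hc.le]
      _ ≤ ∫⁻ τ in Icc (0 : ℝ) T, localSliceEnergy (Kerr.exterior M a) ψ τ R :=
          setLIntegral_mono' measurableSet_Icc fun τ hτ ↦ hloc τ hτ.1 hτ.2
      _ ≤ ∫⁻ τ in Ici (0 : ℝ), localSliceEnergy (Kerr.exterior M a) ψ τ R :=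
          lintegral_mono_set Icc_subset_Ici_self
  -- upper bound: the putative integrated estimate for this admissible localised solution
  have hup : ∫⁻ τ in Ici (0 : ℝ), localSliceEnergy (Kerr.exterior M a) ψ τ R ≤
      ENNReal.ofReal (|C'| * |C|) :=
    calc ∫⁻ τ in Ici (0 : ℝ), localSliceEnergy (Kerr.exterior M a) ψ τ R
        ≤ ENNReal.ofReal C' * sliceEnergy (Kerr.exterior M a) ψ 0 := hall ψ hψ hsupp
      _ ≤ ENNReal.ofReal |C'| * ENNReal.ofReal |C| :=
          mul_le_mul' (ENNReal.ofReal_le_ofReal (le_abs_self C'))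
            (hE₀.trans (ENNReal.ofReal_le_ofReal (le_abs_self C)))
      _ = ENNReal.ofReal (|C'| * |C|) := (ENNReal.ofReal_mul (abs_nonneg C')).symm
  have hlt : ENNReal.ofReal (|C'| * |C|) < ENNReal.ofReal (c * T) :=
    (ENNReal.ofReal_lt_ofReal_iff (by positivity)).2 (by rw [hcT]; linarith)
  exact absurd (hlow.trans hup) (not_le.2 hlt)

end Literature.Barriers.FinalStateConjecture

end
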